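import Summits.QuantumFields.YangMills.Theorems.AllWindowsColdBoxBoxHighLineK3PrimeRowSumFinal
import Summits.QuantumFields.YangMills.Theorems.AllWindowsColdBoxBoxHighLineK3PrimeRowE1r
import Summits.QuantumFields.YangMills.Theorems.AllWindowsColdBoxBoxHighLineK3PrimeRowRA
import Summits.QuantumFields.YangMills.Theorems.AllWindowsColdBoxBoxHighLineK3PrimeRowVertexRecord
import Summits.QuantumFields.YangMills.Theorems.AllWindowsColdBoxBoxHighLineK4PrimeRowSumFinal
import Summits.QuantumFields.YangMills.Theorems.AllWindowsColdBoxBoxHighLineLandauThirdOrderOfSizes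

/-!
# U5 BY NAME: `hK3` unconditional, and `stub_landauThirdOrder` of LINE-20 (⟨stmt-QuantumFields-24336⟩) from ✓`landauThirdOrder_of_sizes₂ hK3 hK4`
# (planner ym-idea-2 g19 owner table 2026-08-30T02:15:47Z / 02:28:37Z «ROW-SUM + finals ← fcl-p3»; ASSEMBLY-U5 §7–§9)

Seat ym-line-fcl-p3 g27 (cell ym-idea-1), assembling the cell's bricks BY NAME — nothing new is estimated here:

* ★★★ `tiltCum3_cutSet_size₀ : <w2 g33's hK3 VERBATIM>` — the third tilted cumulant `κ₃,₀^{μ_D}(c_x, c_y; tiltU)` on every admissible symmetric cut set at the point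
  of record is `≤ K β H` with `β²H⁸·K → 0`, for EVERY `0 < θ < 1/10`: ✓`K3RowSum.tiltCum3_cutSet_size'` (p757110; the K3′ row sum: composition ✓p755232 over ✓p754437/✓p754895,
  rows E1-ghost/E1-Haar/E2 ✓p755479, RB ✓p756819, RC ✓p756575 (fcl-p3), RD/RE ✓p756159 (w5 g24)) fed with the remainder even vertex of record
  `Vr β H a := −(β·Σ_p Σ_{ijkl} Q_{ijkl}(v^p_i·v^p_j)(v^p_k·v^p_l)) − β·phiQuartic H a` (`Q`, measurability and the small-field-box bound = ✓`K3RowSum.vertex_of_record`, w4 g30, over w3 g42's ✓7a⁽⁴⁾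
  `exists_quarticTensor_quarticWilson`), `hE1r := K3RowSum.rowBound_E1r` (w3 g42 over w2 g33's Φ⁴ row) and `hRA := GaussRestrict.rowBound_RA` (w4 g30 over LEAD g78's 7d⁽⁴⁾,
  (γ), ✓phiTaylor, ✓haarTaylor);
* ★★★ `stub_landauThirdOrder` — **the registered stub U5 of LINE-20 BY NAME AND SIGNATURE** (`Lines/landau_rung3.lean` l.235):
  `∀ θL < 1/10, LandauKernelPackage → LandauRepresentativeBound → LandauBallUniqueness → (∃ κ, 0 < κ ∧ κ < 1/2 − 2θL ∧ GaugeBallReduction θL κ) → LandauRelativeComparisonBulk θL`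
  `:= landauThirdOrder_of_sizes₂ tiltCum3_cutSet_size₀ tiltCum4_cutSet_size` (w2 g33's ✓p753567 bookkeeping; hK4 = w4 g30's ✓`tiltCum4_cutSet_size`).
* Downstream BY NAME (not restated here — dedup): w2 g33's ✓`LandauRung3.landauRelativeComparisonBulk_of_sizes` / `boxTwoPointDomination_of_sizes` / `boxWindowMid_of_sizes`
  applied to `tiltCum3_cutSet_size₀` and ✓`tiltCum4_cutSet_size` give the bulk comparison for every `θL < 1/10` and the MID window `BoxWindowSU22 (1/13) (1/11)`
  (route item ⟨stmt-QuantumFields-25580⟩, filed separately as `…BoxWindowMidSU221311Holds`).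

No definitions; tree only; standard axioms.  HONEST LABEL: this closes the registered stub `stub_landauThirdOrder` (U5) of the line skeleton; the crux ⟨stmt-QuantumFields-24336⟩ `BoxWindowHighSU2213` still has the DECLARED RESIDUAL U6 (`BoxWindowHighSU22 (1/11)`, RG regime,
NOT attacked) and is NOT closed by this file; ⟨24004⟩ likewise; route AllWindowsColdBox is DRAFT; **the Yang–Mills mass gap is NOT proved by this file; no summit is
proved by a line.**
-/

set_option autoImplicit false

noncomputable section

open MeasureTheory
open Literature.Probability.LatticeModels (Site)
open Literature.MathematicalPhysics.QuantumLattice (ZdPlaquette plaquettesTouching)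
open Literature.MathematicalPhysics.QuantumFieldTheory.AxialGauge (boxEdges)
open Summit.QuantumFields.YangMills.Theorems.WeakCouplingRates (plaq12At)

namespace Summit.QuantumFields.YangMills.Theorems.AllWindowsColdBoxBoxHighLine

/-- ★★★ **`hK3` — the third tilted cumulant on every admissible cut set, with its budget, for every `0 < θ < 1/10` — UNCONDITIONAL, BY NAME.** -/
theorem tiltCum3_cutSet_size₀ :
    ∀ θ : ℝ, 0 < θ → θ < 1 / 10 → ∃ q : ℝ, ∃ K : ℝ → ℕ → ℝ,
      (∃ β₀ : ℝ, 1 ≤ β₀ ∧ ∀ β : ℝ, β₀ ≤ β → ∀ H : ℕ, 1 ≤ H → β ^ θ ≤ (H : ℝ) → (H : ℝ) ≤ β ^ θ + 1 →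
        ∀ D : Set (LandauFree H → E3), MeasurableSet D → D ⊆ smallField H (β ^ ((1 / 8 - θ / 4) - 1 / 2)) → (∀ a, -a ∈ D ↔ a ∈ D) →
        gaussAvg β H (fun a => 1 - D.indicator (fun _ => (1 : ℝ)) a) ≤ β ^ (-q) →
        gaussAvg β H (fun a => 1 - D.indicator (fun _ => (1 : ℝ)) a) ≤ 1 / 2 → (∀ a ∈ D, |tiltU β H a| ≤ 2) → ∀ x y : Site 4,
        |Tilt.tiltCum3 (((volume : Measure (LandauFree H → E3)).restrict D).withDensity fun a => ENNReal.ofReal (gaussWeight β H a))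
            (tiltU β H) 0 (chartPlaqCost H x 1 2) (chartPlaqCost H y 1 2)| ≤ K β H) ∧
      (∀ ε : ℝ, 0 < ε → ∃ β₀ : ℝ, 1 ≤ β₀ ∧ ∀ β : ℝ, β₀ ≤ β → ∀ H : ℕ, 1 ≤ H → (H : ℝ) ≤ β ^ θ + 1 → β ^ 2 * (H : ℝ) ^ 8 * K β H ≤ ε) := by
  obtain ⟨Q, hQ, mW4, hW4, mVr, bVr⟩ := K3RowSum.vertex_of_record
  exact K3RowSum.tiltCum3_cutSet_size'
    (fun β H a => -(β * ∑ p ∈ plaquettesTouching (boxEdges 4 (2 * H + 1)), ∑ i : Fin 4, ∑ j : Fin 4, ∑ k : Fin 4, ∑ l : Fin 4, Q i j k l *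
        ((WithLp.ofLp (plaqVar H p.1 p.2.1.1 p.2.1.2 a i) ⬝ᵥ WithLp.ofLp (plaqVar H p.1 p.2.1.1 p.2.1.2 a j)) *
          (WithLp.ofLp (plaqVar H p.1 p.2.1.1 p.2.1.2 a k) ⬝ᵥ WithLp.ofLp (plaqVar H p.1 p.2.1.1 p.2.1.2 a l)))) - β * phiQuartic H a)
    mVr (fun β H s _ _ => bVr β H s)
    (fun θ hθ hθ' => K3RowSum.rowBound_E1r θ hθ hθ' (1 / 2) Q hQ)
    (GaussRestrict.rowBound_RA (fun β H a => β * ∑ p ∈ plaquettesTouching (boxEdges 4 (2 * H + 1)), ∑ i : Fin 4, ∑ j : Fin 4, ∑ k : Fin 4, ∑ l : Fin 4, Q i j k l *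
        ((WithLp.ofLp (plaqVar H p.1 p.2.1.1 p.2.1.2 a i) ⬝ᵥ WithLp.ofLp (plaqVar H p.1 p.2.1.1 p.2.1.2 a j)) *
          (WithLp.ofLp (plaqVar H p.1 p.2.1.1 p.2.1.2 a k) ⬝ᵥ WithLp.ofLp (plaqVar H p.1 p.2.1.1 p.2.1.2 a l)))) mW4 81920 (by norm_num) hW4)

/-- ★★★ **Stub U5 of LINE-20 (`stub_landauThirdOrder`), BY NAME AND SIGNATURE** — the third-order Landau-gauge step: the bulk relative Dirichlet comparison
`LandauRelativeComparisonBulk θL` for every `θL < 1/10`, from the kernel package, the representative bound, ball uniqueness and a gauge-ball reduction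
(✓`landauThirdOrder_of_sizes₂` with `hK3 := tiltCum3_cutSet_size₀`, `hK4 := tiltCum4_cutSet_size`). -/
theorem stub_landauThirdOrder : ∀ θL : ℝ, θL < 1 / 10 → LandauKernelPackage → LandauRepresentativeBound → LandauBallUniqueness →
    (∃ κ : ℝ, 0 < κ ∧ κ < 1 / 2 - 2 * θL ∧ GaugeBallReduction θL κ) →
    LandauRelativeComparisonBulk θL :=
  landauThirdOrder_of_sizes₂ tiltCum3_cutSet_size₀ tiltCum4_cutSet_size

end Summit.QuantumFields.YangMills.Theorems.AllWindowsColdBoxBoxHighLine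

end
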